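import Summits.CriticalPhenomena.PercolationContinuityZ3.Theorems.PercNearOneGluingNoHeavyLowerTailNineTypePHO
import Summits.CriticalPhenomena.PercolationContinuityZ3.Theorems.PercNearOneGluingNoHeavyLowerTailNineTypeAllH
import Summits.CriticalPhenomena.PercolationContinuityZ3.Theorems.PercNearOneGluingNoHeavyLowerTailNineTypeRadical2

/-!
# Nine-type programme for `Q44b`: the COUNT for every configuration whose H-dependencies are pure

Support file for crux `stmt-CriticalPhenomena-4575` (`Q44b`, GF(2)-rank line of `prim-bnk-1`), seat `prim-bnk-1`
gen 19; memo `run/shared/lean/prim/prim-l12/FROM-prim-bnk-1-gen19-HALL-GRAM-ASSEMBLY.md` §7–§10.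

MAIN THEOREM (`NineType.card_le_of_pure_dependencies`): a CONT/COV typed configuration `𝒯` with goods `𝔊` (an up-set
containing the HL- and HH-forced unions) in which every H-dependency (nonempty subfamily without an odd target)
consists of points of types `5, 7, 8, 9` only satisfies `#𝒯 ≤ #𝔊`.  Ingredients: PHO (`…NineTypePHO`);
`radical_certificate₂` (`…NineTypeRadical2`);
`exists_pureDefects` (size-ascending greedy basis and pure circuits through the defects; base case
`allH_exists_odd_target`); `card_le_of_pureDefects` (assembly through `card_le_card_of_coreps`).
The residual of `Q44b ∀n` on this line is K1 for IMPURE circuits (a type-6 member, rarely 1/2).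
Pure finite combinatorics; no named facts, no sorries, standard axioms.
-/

namespace Summit.CriticalPhenomena.PercolationContinuityZ3.Theorems

namespace NineType

open Finset

variable {α : Type*} [DecidableEq α] [Fintype α]

/-- **From pure defect data to the count.** [this work] -/
theorem card_le_of_pureDefects (𝒯 : Finset (Finset α)) (θ : Finset α → ℕ)
    (hθ : ∀ s ∈ 𝒯, 1 ≤ θ s ∧ θ s ≤ 9)
    (hcov : ∀ s ∈ 𝒯, ∀ s' ∈ 𝒯, s ≠ s' → s ∪ s' ≠ univ)
    (𝔊 : Finset (Finset α)) (hG : ∀ g ∈ 𝔊, ∀ g' : Finset α, g ⊆ g' → g' ∈ 𝔊)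
    (hHL : ∀ s ∈ 𝒯, ∀ s' ∈ 𝒯, hlOK (θ s) (θ s') = true → s ∪ s'ᶜ ∈ 𝔊)
    (hHH : ∀ s ∈ 𝒯, ∀ s' ∈ 𝒯, s ≠ s' → hhOK (θ s) (θ s') = true → s ∪ s' ∈ 𝔊)
    (D : Finset (Finset α)) (hD : (D ⊆ 𝒯 ∧ (∀ d ∈ D, θ d = 5 ∨ θ d = 7) ∧
      (∀ 𝒮 ⊆ 𝒯 \ D, 𝒮.Nonempty → ∃ T ∈ 𝔊, Odd #(𝒮.filter (fun S => S ⊆ T))) ∧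
      (∀ d ∈ D, ∃ Y A : Finset (Finset α), Y ⊆ insert d (𝒯 \ D) ∧ A ⊆ 𝒯 \ D ∧ d ∈ Y ∧
        (∀ y ∈ Y, θ y = 5 ∨ θ y = 7) ∧ (∀ a ∈ A, θ a = 8 ∨ θ a = 9) ∧ (∀ y ∈ Y, #y ≤ #d) ∧
        (∀ g ∈ 𝔊, ((#(Y.filter (fun y => y ⊆ g)) : ℕ) : ZMod 2) = ((#(A.filter (fun a => a ⊆ g)) : ℕ) : ZMod 2))))) : #𝒯 ≤ #𝔊 := by
  classical
  obtain ⟨hDT, hDfree, hB, hcirc⟩ := hD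
  -- degenerate ground type: if `univ = ∅` every point is `univ`, so #𝒯 ≤ 1 ≤ #𝔊
  by_cases hα : (univ : Finset α) = ∅
  · by_cases hT : 𝒯 = ∅
    · rw [hT, Finset.card_empty]; exact Nat.zero_le _
    · obtain ⟨s, hs⟩ := Finset.nonempty_iff_ne_empty.2 hT
      have hall : ∀ x ∈ 𝒯, x = univ := fun x _ =>
        Finset.eq_univ_of_forall fun e => absurd (Finset.mem_univ e) (by rw [hα]; exact Finset.notMem_empty e)
      have h1 : #𝒯 ≤ 1 := Finset.card_le_one.2 fun x hx y hy => by rw [hall x hx, hall y hy]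
      have hgood : s ∪ sᶜ ∈ 𝔊 := hHL s hs s hs (hlOK_self _ (hθ s hs))
      exact h1.trans (Finset.one_le_card.2 ⟨_, hgood⟩)
  -- co-representatives dᶜ are outside 𝒯 (COV) and injective
  have hfree_ne_compl : ∀ d ∈ D, ∀ s ∈ 𝒯, dᶜ ≠ s := by
    intro d hd s hs h
    have hne : d ≠ s := by
      intro hds
      apply hα
      have h1 : dᶜ = d := h.trans hds.symm
      have h2 : d = univ := by
        have := Finset.union_compl d; rw [h1, Finset.union_idempotent] at this; exact this
      rw [← Finset.compl_univ, ← h2, h1, h2]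
    exact hcov d (hDT hd) s hs hne (by rw [← h]; exact Finset.union_compl d)
  have hρE : ∀ d ∈ D, dᶜ ∉ 𝒯 := fun d hd hmem => hfree_ne_compl d hd _ hmem rfl
  refine card_le_card_of_coreps 𝒯 𝔊 D hDT (fun d => dᶜ) hρE (fun x _ y _ hxy => compl_injective hxy) hB ?_
  -- hW: for nonempty R ⊆ D and 𝒮 ⊆ 𝒯 \ D, an odd target for 𝒮 ∪ comp(R); pick d ∈ R of minimal cardinality
  intro R hR hRne 𝒮 h𝒮
  obtain ⟨d, hdR, hdmin⟩ := Finset.exists_min_image R (fun r => #r) hRne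
  have hd : d ∈ D := hR hdR
  obtain ⟨Y, A, hY, hA, hdY, hYf, hAa, hYle, hdep⟩ := hcirc d hd
  have hYT : Y ⊆ 𝒯 := by
    intro y hy
    rcases Finset.mem_insert.1 (hY hy) with h | h
    · rw [h]; exact hDT hd
    · exact (Finset.mem_sdiff.1 h).1
  have hAT : A ⊆ 𝒯 := fun a ha => (Finset.mem_sdiff.1 (hA ha)).1
  have hrad := pure_halfsum_orthogonal 𝒯 θ hθ hcov 𝔊 hG hHL hHH Y A hYT hAT hYf hAa hdep
  have hcert := radical_certificate₂ 𝔊 hG Y d hdY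
    (fun y hy => hHL y (hYT hy) d (hDT hd) (hlOK_free _ _ (hYf y hy) (hDfree d hd)))
    (fun y hy hdy => (Finset.eq_of_subset_of_card_le hdy (hYle y hy)).symm)
    𝒮 (R.erase d) (fun s hs => hrad s (Finset.mem_sdiff.1 (h𝒮 hs)).1) ?_
  · -- convert ¬(∀ g, parity = [dᶜ ⊆ g]) into an odd target for 𝒮 ∪ comp(R)
    have hex : ∃ g ∈ 𝔊, ((#(𝒮.filter (fun s => s ⊆ g)) : ℕ) : ZMod 2)
        + ((#((R.erase d).filter (fun r => rᶜ ⊆ g)) : ℕ) : ZMod 2) ≠ if dᶜ ⊆ g then 1 else 0 := by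
      by_contra hno
      apply hcert
      intro g hg
      by_contra hneq
      exact hno ⟨g, hg, hneq⟩
    obtain ⟨g, hg, hneq⟩ := hex
    refine ⟨g, hg, ?_⟩
    have hsplit : #(R.filter (fun r => rᶜ ⊆ g)) = #((R.erase d).filter (fun r => rᶜ ⊆ g)) + (if dᶜ ⊆ g then 1 else 0) := by
      rw [← Finset.insert_erase hdR, Finset.filter_insert]
      by_cases hdg : dᶜ ⊆ g
      · rw [if_pos hdg, if_pos hdg, Finset.card_insert_of_notMem]
        · rw [Finset.insert_erase hdR]
        · intro hmem; exact (Finset.mem_erase.1 (Finset.mem_filter.1 hmem).1).1 rfl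
      · rw [if_neg hdg, if_neg hdg, add_zero, Finset.insert_erase hdR]
    rw [hsplit, ← add_assoc]
    have hcast : ((#(𝒮.filter (fun s => s ⊆ g)) + #((R.erase d).filter (fun r => rᶜ ⊆ g)) : ℕ) : ZMod 2)
        ≠ (if dᶜ ⊆ g then 1 else 0) := by push_cast; exact hneq
    exact odd_add_of_parity_ne _ _ hcast
  · -- the co-rows of R \ {d}: y ∪ rᶜ good (free–free HL) and r ⊄ y (sizes)
    intro r hr y hy
    rcases Finset.mem_erase.1 hr with ⟨hrd, hrR⟩
    have hrD : r ∈ D := hR hrR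
    refine ⟨hHL y (hYT hy) r (hDT hrD) (hlOK_free _ _ (hYf y hy) (hDfree r hrD)), ?_⟩
    intro hry
    -- y ⊇ r, #y ≤ #d ≤ #r ⇒ y = r; but y ∈ insert d (𝒯 \ D) and r ∈ D, r ≠ d
    have hyr : y = r := (Finset.eq_of_subset_of_card_le hry ((hYle y hy).trans (hdmin r hrR))).symm
    rcases Finset.mem_insert.1 (hY hy) with h | h
    · exact hrd (hyr.symm.trans h)
    · exact (Finset.mem_sdiff.1 h).2 (hyr ▸ hrD)

/-- **Greedy construction of pure defect data.**  If every H-dependency of the configuration is pure (members of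
types 5,7,8,9 only), a defect set with pure circuits through each defect exists: add the free points in order of
increasing cardinality; a point that creates a dependency becomes a defect, with that (pure) dependency as its
circuit. [this work] -/
theorem exists_pureDefects : ∀ (n : ℕ) (𝒯 : Finset (Finset α)) (θ : Finset α → ℕ),
    #(𝒯.filter (fun s => θ s = 5 ∨ θ s = 7)) = n →
    (∀ s ∈ 𝒯, 1 ≤ θ s ∧ θ s ≤ 9) →
    (∀ s ∈ 𝒯, ∀ s' ∈ 𝒯, s ⊆ s' → (θ s, θ s') ∈ contPairs) →
    ∀ (𝔊 : Finset (Finset α)), (∀ g ∈ 𝔊, ∀ g' : Finset α, g ⊆ g' → g' ∈ 𝔊) →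
    (∀ s ∈ 𝒯, ∀ s' ∈ 𝒯, hlOK (θ s) (θ s') = true → s ∪ s'ᶜ ∈ 𝔊) →
    (∀ 𝒮 ⊆ 𝒯, 𝒮.Nonempty → (∀ g ∈ 𝔊, ¬ Odd #(𝒮.filter (fun S => S ⊆ g))) →
        ∀ s ∈ 𝒮, θ s = 5 ∨ θ s = 7 ∨ θ s = 8 ∨ θ s = 9) →
    ∃ D : Finset (Finset α), (D ⊆ 𝒯 ∧ (∀ d ∈ D, θ d = 5 ∨ θ d = 7) ∧
      (∀ 𝒮 ⊆ 𝒯 \ D, 𝒮.Nonempty → ∃ T ∈ 𝔊, Odd #(𝒮.filter (fun S => S ⊆ T))) ∧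
      (∀ d ∈ D, ∃ Y A : Finset (Finset α), Y ⊆ insert d (𝒯 \ D) ∧ A ⊆ 𝒯 \ D ∧ d ∈ Y ∧
        (∀ y ∈ Y, θ y = 5 ∨ θ y = 7) ∧ (∀ a ∈ A, θ a = 8 ∨ θ a = 9) ∧ (∀ y ∈ Y, #y ≤ #d) ∧
        (∀ g ∈ 𝔊, ((#(Y.filter (fun y => y ⊆ g)) : ℕ) : ZMod 2) = ((#(A.filter (fun a => a ⊆ g)) : ℕ) : ZMod 2)))) := by
  intro n
  induction n with
  | zero =>
    intro 𝒯 θ hn hθ hcont 𝔊 hG hHL _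
    refine ⟨∅, Finset.empty_subset _, fun d hd => absurd hd (Finset.notMem_empty d), ?_,
      fun d hd => absurd hd (Finset.notMem_empty d)⟩
    intro 𝒮 h𝒮 hne
    rw [Finset.sdiff_empty] at h𝒮
    have hno57 : ¬ ∃ t ∈ 𝒯, θ t = 5 ∨ θ t = 7 := by
      rintro ⟨t, ht, h57⟩
      have : t ∈ 𝒯.filter (fun s => θ s = 5 ∨ θ s = 7) := Finset.mem_filter.2 ⟨ht, h57⟩
      rw [Finset.card_eq_zero.1 hn] at this
      exact Finset.notMem_empty t this
    have hGup : IsUpperSet (𝔊 : Set (Finset α)) := fun a b hab ha => hG a ha b hab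
    exact allH_exists_odd_target 𝒯 θ hθ (fun h => hno57 h.1) hcont 𝔊 hGup hHL 𝒮 h𝒮 hne
  | succ n ih =>
    intro 𝒯 θ hn hθ hcont 𝔊 hG hHL hpure
    -- a free point of maximal cardinality
    have hFne : (𝒯.filter (fun s => θ s = 5 ∨ θ s = 7)).Nonempty := by
      rw [← Finset.card_pos, hn]; exact Nat.succ_pos n
    obtain ⟨t, htF, htmax⟩ := Finset.exists_max_image _ (fun s => #s) hFne
    have ht : t ∈ 𝒯 := (Finset.mem_filter.1 htF).1
    have ht57 : θ t = 5 ∨ θ t = 7 := (Finset.mem_filter.1 htF).2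
    -- the configuration without t
    set 𝒯' := 𝒯.erase t with h𝒯'
    have hsub : 𝒯' ⊆ 𝒯 := Finset.erase_subset t 𝒯
    have hn' : #(𝒯'.filter (fun s => θ s = 5 ∨ θ s = 7)) = n := by
      have : 𝒯'.filter (fun s => θ s = 5 ∨ θ s = 7) = (𝒯.filter (fun s => θ s = 5 ∨ θ s = 7)).erase t := by
        rw [h𝒯', Finset.filter_erase]
      rw [this, Finset.card_erase_of_mem htF, hn]; rfl
    obtain ⟨D', hD'T, hD'free, hB', hcirc'⟩ := ih 𝒯' θ hn' (fun s hs => hθ s (hsub hs))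
      (fun s hs s' hs' => hcont s (hsub hs) s' (hsub hs')) 𝔊 hG
      (fun s hs s' hs' => hHL s (hsub hs) s' (hsub hs'))
      (fun 𝒮 h𝒮 hne hno => hpure 𝒮 (h𝒮.trans hsub) hne hno)
    have htD' : t ∉ D' := fun h => Finset.notMem_erase t 𝒯 (hD'T h)
    have hsd : 𝒯 \ D' = insert t (𝒯' \ D') := by
      ext x
      simp only [Finset.mem_sdiff, Finset.mem_insert, h𝒯', Finset.mem_erase]
      constructor
      · rintro ⟨hx, hxD⟩
        by_cases hxt : x = t
        · exact Or.inl hxt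
        · exact Or.inr ⟨⟨hxt, hx⟩, hxD⟩
      · rintro (hxt | ⟨⟨_, hx⟩, hxD⟩)
        · exact ⟨hxt ▸ ht, hxt ▸ htD'⟩
        · exact ⟨hx, hxD⟩
    by_cases hind : ∀ 𝒮 ⊆ insert t (𝒯' \ D'), 𝒮.Nonempty → ∃ T ∈ 𝔊, Odd #(𝒮.filter (fun S => S ⊆ T))
    · -- t joins the basis
      refine ⟨D', hD'T.trans hsub, hD'free, ?_, ?_⟩
      · rw [hsd]; exact hind
      · intro d hd
        obtain ⟨Y, A, hY, hA, hdY, hYf, hAa, hYle, hdep⟩ := hcirc' d hd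
        refine ⟨Y, A, ?_, ?_, hdY, hYf, hAa, hYle, hdep⟩
        · intro y hy
          rcases Finset.mem_insert.1 (hY hy) with h | h
          · exact Finset.mem_insert.2 (Or.inl h)
          · rw [hsd]; exact Finset.mem_insert.2 (Or.inr (Finset.mem_insert_of_mem h))
        · rw [hsd]; exact fun a ha => Finset.mem_insert_of_mem (hA ha)
    · -- t becomes a defect with a pure dependency through it
      have hind' : ∃ 𝒮₀ : Finset (Finset α), 𝒮₀ ⊆ insert t (𝒯' \ D') ∧ 𝒮₀.Nonempty ∧
          ∀ T ∈ 𝔊, ¬ Odd #(𝒮₀.filter (fun S => S ⊆ T)) := by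
        by_contra hno
        apply hind
        intro 𝒮 h𝒮 hne
        by_contra hno2
        exact hno ⟨𝒮, h𝒮, hne, fun T hT hodd => hno2 ⟨T, hT, hodd⟩⟩
      obtain ⟨𝒮₀, h𝒮₀, hne₀, hno₀'⟩ := hind'
      have h𝒮₀T : 𝒮₀ ⊆ 𝒯 := by
        intro x hx
        rcases Finset.mem_insert.1 (h𝒮₀ hx) with h | h
        · rw [h]; exact ht
        · exact hsub (Finset.mem_sdiff.1 h).1
      have htypes := hpure 𝒮₀ h𝒮₀T hne₀ hno₀'
      -- t ∈ 𝒮₀ (otherwise 𝒮₀ ⊆ basis of 𝒯', contradicting hB')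
      have ht𝒮₀ : t ∈ 𝒮₀ := by
        by_contra htn
        have hS' : 𝒮₀ ⊆ 𝒯' \ D' := by
          intro x hx
          rcases Finset.mem_insert.1 (h𝒮₀ hx) with h | h
          · exact absurd (h ▸ hx) htn
          · exact h
        obtain ⟨T, hT, hodd⟩ := hB' 𝒮₀ hS' hne₀
        exact hno₀' T hT hodd
      set Y := 𝒮₀.filter (fun s => θ s = 5 ∨ θ s = 7) with hYdef
      set A := 𝒮₀.filter (fun s => θ s = 8 ∨ θ s = 9) with hAdef
      have hYA : 𝒮₀ = Y ∪ A := by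
        ext x
        simp only [hYdef, hAdef, Finset.mem_union, Finset.mem_filter]
        constructor
        · intro hx
          rcases htypes x hx with h | h | h | h
          · exact Or.inl ⟨hx, Or.inl h⟩
          · exact Or.inl ⟨hx, Or.inr h⟩
          · exact Or.inr ⟨hx, Or.inl h⟩
          · exact Or.inr ⟨hx, Or.inr h⟩
        · rintro (⟨hx, _⟩ | ⟨hx, _⟩) <;> exact hx
      have hdisj : Disjoint Y A := by
        rw [Finset.disjoint_left]
        intro x hxY hxA
        rcases (Finset.mem_filter.1 hxY).2 with h | h <;> rcases (Finset.mem_filter.1 hxA).2 with h' | h' <;> omega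
      refine ⟨insert t D', ?_, ?_, ?_, ?_⟩
      · exact Finset.insert_subset ht (hD'T.trans hsub)
      · intro d hd
        rcases Finset.mem_insert.1 hd with h | h
        · rw [h]; exact ht57
        · exact hD'free d h
      · -- basis unchanged: 𝒯 \ insert t D' = 𝒯' \ D'
        have hbas : 𝒯 \ insert t D' = 𝒯' \ D' := by
          ext x
          simp only [Finset.mem_sdiff, Finset.mem_insert, h𝒯', Finset.mem_erase, not_or]
          tauto
        rw [hbas]; exact hB'
      · intro d hd
        have hbas : 𝒯 \ insert t D' = 𝒯' \ D' := by
          ext x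
          simp only [Finset.mem_sdiff, Finset.mem_insert, h𝒯', Finset.mem_erase, not_or]
          tauto
        rcases Finset.mem_insert.1 hd with h | h
        · -- the new defect t
          subst h
          refine ⟨Y, A, ?_, ?_, ?_, ?_, ?_, ?_, ?_⟩
          · intro y hy
            rw [hbas]
            exact h𝒮₀ (Finset.mem_filter.1 hy).1
          · intro a ha
            rw [hbas]
            have ha𝒮 : a ∈ 𝒮₀ := (Finset.mem_filter.1 ha).1
            rcases Finset.mem_insert.1 (h𝒮₀ ha𝒮) with h | h
            · exfalso
              rcases (Finset.mem_filter.1 ha).2 with h8 | h9 <;> rcases ht57 with h5 | h7 <;> rw [h] at * <;> omega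
            · exact h
          · exact Finset.mem_filter.2 ⟨ht𝒮₀, ht57⟩
          · exact fun y hy => (Finset.mem_filter.1 hy).2
          · exact fun a ha => (Finset.mem_filter.1 ha).2
          · intro y hy
            have hyT : y ∈ 𝒯 := h𝒮₀T (Finset.mem_filter.1 hy).1
            exact htmax y (Finset.mem_filter.2 ⟨hyT, (Finset.mem_filter.1 hy).2⟩)
          · intro g hg
            have hev : ¬ Odd #(𝒮₀.filter (fun S => S ⊆ g)) := hno₀' g hg
            rw [hYA, card_filter_union_of_disjoint Y A hdisj] at hev
            rw [Nat.not_odd_iff_even] at hev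
            have h0 : ((#(Y.filter (fun y => y ⊆ g)) : ℕ) : ZMod 2)
                + ((#(A.filter (fun a => a ⊆ g)) : ℕ) : ZMod 2) = 0 := by
              rw [← Nat.cast_add]; exact (ZMod.natCast_eq_zero_iff_even).2 hev
            have heq : ∀ x y : ZMod 2, x + y = 0 → x = y := by
              intro x y h; fin_cases x <;> fin_cases y <;> first | rfl | exact absurd h (by decide)
            exact heq _ _ h0
        · -- an old defect
          obtain ⟨Y', A', hY', hA', hdY', hYf', hAa', hYle', hdep'⟩ := hcirc' d h
          refine ⟨Y', A', ?_, ?_, hdY', hYf', hAa', hYle', hdep'⟩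
          · rw [hbas]; exact hY'
          · rw [hbas]; exact hA'

/-- **THEOREM (count for configurations with pure dependencies).**  A CONT/COV typed configuration with goods `𝔊`
(an up-set containing the HL- and HH-forced unions) in which every H-dependency consists of points of types
`5, 7, 8, 9` only satisfies `#𝒯 ≤ #𝔊`.  [this work: PHO + radical certificate + assembly + greedy] -/
theorem card_le_of_pure_dependencies (𝒯 : Finset (Finset α)) (θ : Finset α → ℕ)
    (hθ : ∀ s ∈ 𝒯, 1 ≤ θ s ∧ θ s ≤ 9)
    (hcont : ∀ s ∈ 𝒯, ∀ s' ∈ 𝒯, s ⊆ s' → (θ s, θ s') ∈ contPairs)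
    (hcov : ∀ s ∈ 𝒯, ∀ s' ∈ 𝒯, s ≠ s' → s ∪ s' ≠ univ)
    (𝔊 : Finset (Finset α)) (hG : ∀ g ∈ 𝔊, ∀ g' : Finset α, g ⊆ g' → g' ∈ 𝔊)
    (hHL : ∀ s ∈ 𝒯, ∀ s' ∈ 𝒯, hlOK (θ s) (θ s') = true → s ∪ s'ᶜ ∈ 𝔊)
    (hHH : ∀ s ∈ 𝒯, ∀ s' ∈ 𝒯, s ≠ s' → hhOK (θ s) (θ s') = true → s ∪ s' ∈ 𝔊)
    (hpure : ∀ 𝒮 ⊆ 𝒯, 𝒮.Nonempty → (∀ g ∈ 𝔊, ¬ Odd #(𝒮.filter (fun S => S ⊆ g))) →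
      ∀ s ∈ 𝒮, θ s = 5 ∨ θ s = 7 ∨ θ s = 8 ∨ θ s = 9) :
    #𝒯 ≤ #𝔊 := by
  obtain ⟨D, hD⟩ := exists_pureDefects _ 𝒯 θ rfl hθ hcont 𝔊 hG hHL hpure
  exact card_le_of_pureDefects 𝒯 θ hθ hcov 𝔊 hG hHL hHH D hD

/-- Table fact: every type is HL-compatible with types `3` and `4` (their L-rows are perfect containment detectors). -/
theorem hlOK_three_four (x y : ℕ) (hx : 1 ≤ x ∧ x ≤ 9) (hy : y = 3 ∨ y = 4) : hlOK x y = true := by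
  rcases hx with ⟨h1, h9⟩
  interval_cases x <;> rcases hy with rfl | rfl <;> decide

/-- Table fact: a point strictly above a type-3/4 point has type 1, 2, 3 or 4 (CONT). -/
theorem contPairs_three_four (x y : ℕ) (hx : x = 3 ∨ x = 4) (h : (x, y) ∈ contPairs) :
    y = 1 ∨ y = 2 ∨ y = 3 ∨ y = 4 := by
  rcases hx with rfl | rfl <;> simp [contPairs] at h <;> omega

/-- **Purity from the type set.**  If no point has type `1`, `2` or `6`, every H-dependency is pure (a type-3/4 member of
maximal cardinality, paired with the perfect detector `u ↦ [pᶜ ⊆ u]`, would lie inside a larger type-3/4 member). [this work] -/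
theorem pure_of_no_126 (𝒯 : Finset (Finset α)) (θ : Finset α → ℕ)
    (hθ : ∀ s ∈ 𝒯, 1 ≤ θ s ∧ θ s ≤ 9)
    (hcont : ∀ s ∈ 𝒯, ∀ s' ∈ 𝒯, s ⊆ s' → (θ s, θ s') ∈ contPairs)
    (𝔊 : Finset (Finset α)) (hG : ∀ g ∈ 𝔊, ∀ g' : Finset α, g ⊆ g' → g' ∈ 𝔊)
    (hHL : ∀ s ∈ 𝒯, ∀ s' ∈ 𝒯, hlOK (θ s) (θ s') = true → s ∪ s'ᶜ ∈ 𝔊)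
    (hno : ∀ s ∈ 𝒯, θ s ≠ 1 ∧ θ s ≠ 2 ∧ θ s ≠ 6) :
    ∀ 𝒮 ⊆ 𝒯, 𝒮.Nonempty → (∀ g ∈ 𝔊, ¬ Odd #(𝒮.filter (fun S => S ⊆ g))) →
      ∀ s ∈ 𝒮, θ s = 5 ∨ θ s = 7 ∨ θ s = 8 ∨ θ s = 9 := by
  intro 𝒮 h𝒮 _ hno_odd
  -- it suffices that no member has type 3 or 4
  by_contra hbad
  have hex : ∃ p ∈ 𝒮, θ p = 3 ∨ θ p = 4 := by
    by_contra hnone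
    apply hbad
    intro s hs
    have h9 := hθ s (h𝒮 hs)
    obtain ⟨hn1, hn2, hn6⟩ := hno s (h𝒮 hs)
    have hn34 : ¬ (θ s = 3 ∨ θ s = 4) := fun h => hnone ⟨s, hs, h⟩
    omega
  -- a type-3/4 member of maximal cardinality
  obtain ⟨p, hpP, hpmax⟩ := Finset.exists_max_image (𝒮.filter (fun s => θ s = 3 ∨ θ s = 4)) (fun s => #s)
    (by obtain ⟨p, hp, h34⟩ := hex; exact ⟨p, Finset.mem_filter.2 ⟨hp, h34⟩⟩)
  have hp : p ∈ 𝒮 := (Finset.mem_filter.1 hpP).1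
  have hp34 : θ p = 3 ∨ θ p = 4 := (Finset.mem_filter.1 hpP).2
  -- pair the dependency with the detector u ↦ [pᶜ ⊆ u]
  have hD : ∑ u ∈ 𝔊.filter (fun u => pᶜ ⊆ u), ((#(𝒮.filter (fun S => S ⊆ u)) : ℕ) : ZMod 2) = 0 := by
    refine Finset.sum_eq_zero fun u hu => ?_
    exact (ZMod.natCast_eq_zero_iff_even).2 (Nat.not_odd_iff_even.1 (hno_odd u (Finset.mem_filter.1 hu).1))
  have hD' : ∑ u ∈ 𝔊.filter (fun u => pᶜ ⊆ u), ((#(𝒮.filter (fun S => S ⊆ u)) : ℕ) : ZMod 2)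
      = ((#(𝒮.filter (fun x => p ⊆ x)) : ℕ) : ZMod 2) := by
    calc ∑ u ∈ 𝔊.filter (fun u => pᶜ ⊆ u), ((#(𝒮.filter (fun S => S ⊆ u)) : ℕ) : ZMod 2)
        = ∑ u ∈ 𝔊, (if pᶜ ⊆ u then ((#(𝒮.filter (fun S => S ⊆ u)) : ℕ) : ZMod 2) else 0) := by
          rw [Finset.sum_filter]
      _ = ∑ u ∈ 𝔊, ∑ x ∈ 𝒮, (if x ∪ pᶜ ⊆ u then (1 : ZMod 2) else 0) := by
          refine Finset.sum_congr rfl fun u _ => ?_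
          by_cases hpu : pᶜ ⊆ u
          · rw [if_pos hpu, card_filter_cast]
            refine Finset.sum_congr rfl fun x _ => ?_
            by_cases hxu : x ⊆ u
            · rw [if_pos hxu, if_pos (Finset.union_subset hxu hpu)]
            · rw [if_neg hxu, if_neg (fun h => hxu (subset_union_left.trans h))]
          · rw [if_neg hpu]; symm
            exact Finset.sum_eq_zero fun x _ => if_neg (fun h => hpu (subset_union_right.trans h))
      _ = ∑ x ∈ 𝒮, ∑ u ∈ 𝔊, (if x ∪ pᶜ ⊆ u then (1 : ZMod 2) else 0) := Finset.sum_comm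
      _ = ∑ x ∈ 𝒮, (if p ⊆ x then (1 : ZMod 2) else 0) := by
          refine Finset.sum_congr rfl fun x hx => ?_
          rw [← card_filter_cast, card_supersets_parity 𝔊 hG (x ∪ pᶜ)
            (hHL x (h𝒮 hx) p (h𝒮 hp) (hlOK_three_four _ _ (hθ x (h𝒮 hx)) hp34))]
          have key : x ∪ pᶜ = univ ↔ p ⊆ x := by
            rw [union_eq_univ_iff_compl_subset x pᶜ, compl_compl]
          by_cases hpx : p ⊆ x
          · rw [if_pos hpx, if_pos (key.2 hpx)]
          · rw [if_neg hpx, if_neg (fun h => hpx (key.1 h))]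
      _ = ((#(𝒮.filter (fun x => p ⊆ x)) : ℕ) : ZMod 2) := (card_filter_cast _ _).symm
  rw [hD'] at hD
  -- so the number of members containing p is even; p is one of them, hence another one exists
  have heven : Even #(𝒮.filter (fun x => p ⊆ x)) := (ZMod.natCast_eq_zero_iff_even).1 hD
  have hpin : p ∈ 𝒮.filter (fun x => p ⊆ x) := Finset.mem_filter.2 ⟨hp, subset_refl p⟩
  have hcard2 : 2 ≤ #(𝒮.filter (fun x => p ⊆ x)) := by
    rcases heven with ⟨k, hk⟩
    have hpos : 0 < #(𝒮.filter (fun x => p ⊆ x)) := Finset.card_pos.2 ⟨p, hpin⟩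
    omega
  obtain ⟨x, hx, hxp⟩ := Finset.exists_mem_ne hcard2 p
  have hxS : x ∈ 𝒮 := (Finset.mem_filter.1 hx).1
  have hpx : p ⊆ x := (Finset.mem_filter.1 hx).2
  have htx := contPairs_three_four _ _ hp34 (hcont p (h𝒮 hp) x (h𝒮 hxS) hpx)
  obtain ⟨hx1, hx2, _⟩ := hno x (h𝒮 hxS)
  have hx34 : θ x = 3 ∨ θ x = 4 := by omega
  -- x is a larger type-3/4 member: contradiction with the maximality of p
  have hle := hpmax x (Finset.mem_filter.2 ⟨hxS, hx34⟩)
  exact hxp (Finset.eq_of_subset_of_card_le hpx hle).symm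

/-- **COROLLARY (no types 1, 2, 6 ⟹ count)**: every CONT/COV configuration with types in `{3,4,5,7,8,9}` (e.g. the frustrated
triangles `{3,5,8}`, `{3,7,8}`, `{4,5,9}`, `{4,7,9}` and the clash block `{5,7,8,9}`) satisfies `#𝒯 ≤ #𝔊`. [this work] -/
theorem card_le_of_no_126 (𝒯 : Finset (Finset α)) (θ : Finset α → ℕ)
    (hθ : ∀ s ∈ 𝒯, 1 ≤ θ s ∧ θ s ≤ 9)
    (hcont : ∀ s ∈ 𝒯, ∀ s' ∈ 𝒯, s ⊆ s' → (θ s, θ s') ∈ contPairs)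
    (hcov : ∀ s ∈ 𝒯, ∀ s' ∈ 𝒯, s ≠ s' → s ∪ s' ≠ univ)
    (𝔊 : Finset (Finset α)) (hG : ∀ g ∈ 𝔊, ∀ g' : Finset α, g ⊆ g' → g' ∈ 𝔊)
    (hHL : ∀ s ∈ 𝒯, ∀ s' ∈ 𝒯, hlOK (θ s) (θ s') = true → s ∪ s'ᶜ ∈ 𝔊)
    (hHH : ∀ s ∈ 𝒯, ∀ s' ∈ 𝒯, s ≠ s' → hhOK (θ s) (θ s') = true → s ∪ s' ∈ 𝔊)
    (hno : ∀ s ∈ 𝒯, θ s ≠ 1 ∧ θ s ≠ 2 ∧ θ s ≠ 6) : #𝒯 ≤ #𝔊 :=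
  card_le_of_pure_dependencies 𝒯 θ hθ hcont hcov 𝔊 hG hHL hHH (pure_of_no_126 𝒯 θ hθ hcont 𝔊 hG hHL hno)

end NineType

end Summit.CriticalPhenomena.PercolationContinuityZ3.Theorems
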